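import Summits.Ventures.PercRepro.RankLevelSetContractMono

/-!
# PercRepro — the AVERAGED contraction monotonicity (MC-avg) implies (MC∃), hence C-025 (night-1, gen 7)

`ContractMonoAvg`: for every finite matroid and `q + 2 ≤ p`, summing over the non-loops `e`,
`Σ_e σ_{M ／ {e}}(p − 1, q) ≤ #nonloops · σ_M(p, q)`.  One global inequality per matroid, no choice of element;
census (mining/night-1/g7/): all 385,370 matroids with ≤ 9 elements, the truncated-sum scans (44,563 cells incl.
every cell where the every-element form (MC) fails), random GF(p) matroids with planted 5–7-point lines —
0 violations, tight at the uniform tight layer.  By the pigeonhole on the average, (MC-avg) ⟹ (MC∃) ⟹ C-025.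
Axioms: standard.
-/

open scoped Matroid

namespace PercRepro

namespace Matroid

open Set

variable {α : Type}

/-- **(MC-avg) — the AVERAGED contraction monotonicity of the slack**: for every finite matroid `M`, every
`q + 2 ≤ p` and the finset `S` of its non-loops, `Σ_{e ∈ S} σ_{M ／ {e}}(p − 1, q) ≤ |S| · σ_M(p, q)`. -/
def ContractMonoAvg : Prop :=
  ∀ {α : Type} (M : _root_.Matroid α) [M.Finite] (p q : ℕ), q + 2 ≤ p →
    ∀ (S : Finset α), (∀ e, e ∈ S ↔ M.IsNonloop e) →
      ∑ e ∈ S, slack (M ／ {e}) (p - 1) q ≤ (S.card : ℚ) * slack M p q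

/-- The non-loops of a finite matroid form a finite set. -/
theorem nonloops_finite (M : _root_.Matroid α) [M.Finite] : {e | M.IsNonloop e}.Finite :=
  M.ground_finite.subset (fun _ he => he.mem_ground)

/-- (MC-avg) implies (MC∃): an element at or below the average. -/
theorem contractMonoExists_of_contractMonoAvg (h : ContractMonoAvg) : ContractMonoExists := by
  intro α M _ p q hpq hex
  set S : Finset α := (nonloops_finite M).toFinset with hS
  have hmem : ∀ e, e ∈ S ↔ M.IsNonloop e := by
    intro e
    rw [hS, (nonloops_finite M).mem_toFinset]
    rfl
  have hsum := h M p q hpq S hmem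
  have hne : S.Nonempty := by
    obtain ⟨e, he⟩ := hex
    exact ⟨e, (hmem e).2 he⟩
  have hsum' : ∑ e ∈ S, slack (M ／ {e}) (p - 1) q ≤ ∑ _e ∈ S, slack M p q := by
    rw [Finset.sum_const, nsmul_eq_mul]
    exact hsum
  obtain ⟨e, heS, hle⟩ := Finset.exists_le_of_sum_le hne hsum'
  exact ⟨e, (hmem e).1 heS, hle⟩

/-- **C-025 FROM (MC-avg)**. -/
theorem c025_of_contractMonoAvg (h : ContractMonoAvg) : C025 :=
  c025_of_contractMonoExists (contractMonoExists_of_contractMonoAvg h)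

end Matroid

end PercRepro
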